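import Mathlib
import Summits.KontsevichZagierPeriods.Zeta5Search.DenomLaw.ZeroPointVFloor
import Summits.KontsevichZagierPeriods.Zeta5Search.CasoratianBoundPalV
import HarnessLib

/-!
# ζ(5) search — the zero-point V-FLOOR glued with THEOREM LB♯'s PALINDROMIC rows («ZVP»; DENOM-LAW D1, prover-d1 gen 21)

HONEST FRAMING: systematic search; no irrationality claim unless certified.  Cell `pub-zeta5`, track «DENOM-LAW» D1, seat `denom-prover-d1` gen 21
(`HOME/denom-law/prover-d1/ATTEMPT-21.md` §2).  `p`-adic valuations of the cell's OWN rationals (the constant-term coefficient `V(b) = coeffV b` and the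
contiguity Casoratian `Cas_j(b)`); nothing about ζ(5); no model exponent; records in print UNMOVED.

WHY.  Gen 20's `cas_ge_of_zeroPointV` (the zero-point law's V-half `‖V(b)‖, ‖V(b+e_j)‖ ≤ p^{M−2}` fed to THEOREM LB's rows `r ≤ 3 + E_x` on multipole
classes) and gen 19's `cas_val_ge_of_coeffV_pal` (THEOREM LB♯: the same assembly with the PALINDROMIC row `r ≤ 4 + E_x` on a centre-free palindromic
multipole class of even exponent `E_x ≤ −3`) are both in the tree; this file is their two-line composition
**`cas_ge_of_zeroPointV_pal`: `(2 − M) + r ≤ v_p(Cas_j(b))`** under `TypeSpaceLawZeroPoint`'s hypotheses, for any row constant `r` with `r ≤ 1`, `r ≤ 0` if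
`p > d`, and on every multipole class `r ≤ 3 + E_x` OR (`E_x ≤ −3`, palindromic configuration, `3 + E_x` odd, `r ≤ 4 + E_x`).
USE (local census of this seat on gen 18's exact tables, `ATTEMPT-21.md` §1–§2): the configuration «deep palindromic pair `[1,−3,−3,1]` / `[−2,−2]` at
`m = −4` above a one-point single-pole layer at `−6`/`−5`» — the two largest heads of what the landed laws (through `ZeroPointVFloor`) leave open —
has `(2 − 6) + min(1, 4 − 4) = −4 =` the ∀-`b` node; as the census rung «ZVP/ZVPs» it closes 2 / 27 / 29 further instances at `p = 5 / 7 / 11`(sample of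
30,000) with 0 port violations, taking the share reached by landed laws to 99.72 % / 99.76 % / 99.85 %.
-/

noncomputable section

open Finset

namespace Summit.KontsevichZagierPeriods.Zeta5Search.SecondOrder

open Summit.KontsevichZagierPeriods.Zeta5Search.WedgeDictionary (coeffV dOf)
open Summit.KontsevichZagierPeriods.Zeta5Search.CasoratianValuation (InPolytope shift casoratian)
open Summit.KontsevichZagierPeriods.Zeta5Search.ClusterValuation
open Summit.KontsevichZagierPeriods.Zeta5Search.ResidueLaw (pointW pointV liveClasses)

variable {p : ℕ}

/-- **The Casoratian from the zero-point V-floor and THEOREM LB♯'s palindromic rows («ZVP»)**: under `TypeSpaceLawZeroPoint`'s hypotheses (window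
prime `5 ≤ p ≤ b₀ < p² − 2`, `M ≥ 6` even, every pole class `E ≥ −M`, the classes at `−M` centre-free with palindromic type list, the degree condition
`p(M−2) + ΣE ≤ −4`, all live doubled orbit points congruent mod `p`) and a row constant `r` with `r ≤ 1`, `r ≤ 0` unless `p ≤ d`, and on every multipole
class `x` either `r ≤ 3 + E_x` or (`E_x ≤ −3`, `IsPalindromic (classConfig b p x)`, `3 + E_x` odd, `r ≤ 4 + E_x`):  `(2 − M) + r ≤ v_p(Cas_j(b))`. -/
theorem cas_ge_of_zeroPointV_pal (b : ℕ → ℤ) (p j M : ℕ) (hb : InPolytope b) (hb' : InPolytope (shift b j))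
    (hj1 : 1 ≤ j) (hj7 : j ≤ 7) (hprime : p.Prime) (hp5 : 5 ≤ p) (hpb : (p : ℤ) ≤ b 0) (hwin : (b 0 + 2 : ℤ) < (p : ℤ) ^ 2)
    (hM : 6 ≤ M) (hMe : Even M)
    (G1 : ∀ x, x < p → 1 ≤ classPoleCount b p x → -(M : ℤ) ≤ classExp b p x)
    (G3 : ∀ x, x < p → 1 ≤ classPoleCount b p x → classExp b p x = -(M : ℤ) →
      ¬ CentreIn b p x ∧ (classTypeList b p x).reverse = classTypeList b p x)
    (hdeg : (p : ℤ) * ((M : ℤ) - 2) + ∑ x ∈ range p, classExp b p x ≤ -4)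
    (HP : ∀ x ∈ liveClasses b p M, ∀ y ∈ liveClasses b p M,
        (pointW b p M y - pointW b p M x = 0 ∨ 1 ≤ padicValRat p (pointW b p M y - pointW b p M x)) ∧
        (pointV b p M y - pointV b p M x = 0 ∨ 1 ≤ padicValRat p (pointV b p M y - pointV b p M x)))
    (r : ℤ) (hr1 : r ≤ 1)
    (hrm : ∀ x, x < p → 2 ≤ classPoleCount b p x →
      r ≤ 3 + classExp b p x ∨
        (classExp b p x ≤ -3 ∧ IsPalindromic (classConfig b p x) ∧ Odd (3 + classExp b p x) ∧ r ≤ 4 + classExp b p x))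
    (hr0 : dOf b < (p : ℤ) → r ≤ 0) (hcas : casoratian b j ≠ 0) :
    (2 - (M : ℤ)) + r ≤ padicValRat p (casoratian b j) := by
  haveI : Fact p.Prime := ⟨hprime⟩
  obtain ⟨hV, hV'⟩ := zeroPoint_vNorm b p j M hb hb' hj1 hj7 hprime hp5 hpb hwin hM hMe G1 G3 hdeg HP
  exact cas_val_ge_of_coeffV_pal b j p hb hj1 hj7 hb' hprime hp5 hpb hwin ((2 : ℤ) - M) r hV hV'
    (fun _ _ _ => hr1) hrm hr0 hcas

end Summit.KontsevichZagierPeriods.Zeta5Search.SecondOrder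

end
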